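import Summits.NavierStokesRegularity.OSWSelfSimilar.SheetRBackboneSolutionOperator
import HarnessLib

/-!
# SHEET-ℝ frame: coercivity of the linearised weak form FROM A POINTWISE DATUM — the certificate's (C1) reduced to one real inequality

HONEST FRAMING (cell ns-blowup GROUP B / zone Z3, cases Z3-SR-CERT (input (C1) of PREREG-SHEET-R-CERT / PRICE-impl1 §2) and Z3-SR-SPEC
((P1): coercivity of the shifted operator); 1-D MODEL certificate frame (viscous gCLM/OSW sheet on the line); not Euler/NS; «violates:
none — MODEL»). Nothing here asserts that a profile exists; NO interval arithmetic is done here — the pointwise inequality is the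
HYPOTHESIS, and this file proves that it is the ONLY thing the interval stage has to deliver for (C1).

`SheetRSolutionOperator.exists_solutionOperator` (selfsim g10) produces the bounded linear solution operator `S : L²_w →L E` of
`−∂² + d∂ + V` GIVEN the coercivity `hcoer : κ(‖v₁‖²_w + ¼‖v‖²_w) ≤ linForm(v; v)` on every compactly supported odd energy-class test —
a statement quantified over a function class, which no interval computation checks directly.  PRICE-impl1 §1 (E3)/§2 (C1) obtains it
from a POINTWISE function: `⟨(B₀ + a𝒰̄∂ − HΩ̄ + λχ)δ, wδ⟩ = ∫ κ_λ w δ² + ‖δ′‖²_w`,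
`κ_λ := (¾L² − 1 + ¼ξ²)/w − (1 + a/2)HΩ̄ − aξ𝒰̄/w + λχ`, and «`κ_λ ≥ ¼` everywhere ⇒ `c_λ = 1`» (in general `c_λ = min(1, 4 min κ_λ)`).
This file makes that reduction KERNEL, for an arbitrary `C¹` drift:

* `linForm_diag_eq` — **the generalised backbone identity at the weak level**: for `d ∈ C¹`, `V` bounded measurable and every
  `IsCompactTest v v₁`,  `linForm L d V v v₁ v v₁ = ∫ w v₁² + ∫ (wV − 1 − ξd − ½w d′) v²`  (one absolutely continuous integration
  by parts of `(2ξ + w d)·(v²)′`, `SheetRBackboneSolutionOperator.integral_mul_test_eq`; no second derivative anywhere);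
* `coercive_of_pointwise` — if `κ ≤ 1` and **`(κ/4)·w(ξ) ≤ w(ξ)V(ξ) − 1 − ξd(ξ) − ½w(ξ)d′(ξ)` for every `ξ`**, then `hcoer` holds
  with that `κ`;
* `exists_solutionOperator_of_pointwise`, `solution_unique_of_pointwise` — the g10 solution operator and its uniqueness with `hcoer`
  DISCHARGED by the pointwise datum (`0 < κ ≤ 1`);
* §4 the sheet's own coefficients `d = ½ξ + a𝒰̄`, `V = 1 − HΩ̄ + λχ` with `𝒰̄′ = HΩ̄` (abstract functions `U`, `h`, `χ`):
  `sheet_potential_eq` — `wV − 1 − ξd − ½wd′ = w·κ_λ` with PRICE-impl1's `κ_λ` VERBATIM — and `sheet_coercive_of_kappa`,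
  `exists_sheet_solutionOperator`: **`κ_λ(ξ) ≥ κ/4` pointwise (`0 < κ ≤ 1`) ⇒ the bounded solution operator of `B_λ` exists with
  `‖S g‖_E ≤ (2/κ)‖g‖_w` and energy-space weak solutions are unique** — at the registered point `κ = 1` this is (C1) ⇒ `‖B_λ⁻¹‖_{w→E} ≤ 2`.

Pure calculus; no definition, no named fact.  WHAT THIS IS NOT: not NS; not the interval evaluation of `κ_λ` (that stays the
certificate's); no number of record moves.
-/

noncomputable section

namespace Summit.NavierStokesRegularity.OSWSelfSimilar
namespace SheetRLinearisedCoercivity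

open _root_.MeasureTheory _root_.Set _root_.Filter _root_.Real SheetRWeakProfilePV SheetRWeakToStrong SheetREnergyClass SheetRWeightedMeasure
  SheetRLinearisedTests SheetREnergySpace SheetRTestSpace SheetRLinearisedFormBounds SheetRSolutionOperator SheetRBackboneSolutionOperator
open scoped Topology ENNReal

/-! ### §1 The generalised backbone identity on the diagonal -/

/-- A compactly supported test has compact support (as a `HasCompactSupport` statement). [folklore] -/
theorem hasCompactSupport_of_isCompactTest {v v₁ : ℝ → ℝ} (hv : IsCompactTest v v₁) : HasCompactSupport v := by
  obtain ⟨R, hR⟩ := hv.support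
  refine HasCompactSupport.intro (isCompact_Icc : IsCompact (Icc (-|R|) |R|)) fun x hx => ?_
  have : R ≤ |x| := by
    have h1 : |R| < |x| := by
      by_contra hle
      exact hx (mem_Icc.2 (abs_le.1 (not_lt.1 hle)))
    linarith [le_abs_self R]
  exact (hR x this).1

/-- For a continuous `F` and a compactly supported test `v`: `F·v²` is integrable. [folklore] -/
theorem integrable_continuous_mul_sq {F v v₁ : ℝ → ℝ} (hF : Continuous F) (hv : IsCompactTest v v₁) :
    Integrable fun y => F y * v y ^ 2 := by
  obtain ⟨hc, -, -, -⟩ := basic_of_isCompactTest hv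
  have hsupp := hasCompactSupport_of_isCompactTest hv
  have hcont : Continuous fun y => F y * v y ^ 2 := hF.mul (hc.pow 2)
  have hcs : HasCompactSupport fun y => F y * v y ^ 2 := by
    refine hsupp.mono fun y hy => ?_
    rw [Function.mem_support] at hy ⊢
    intro h0
    apply hy
    rw [h0]; ring
  exact hcont.integrable_of_hasCompactSupport hcs

/-- For a bounded a.e.-strongly measurable `V` and a compactly supported test `v`: `(L²+ξ²)·V·v²` is integrable. [folklore] -/
theorem integrable_weight_potential_mul_sq {L V₀ : ℝ} {V v v₁ : ℝ → ℝ} (hVm : AEStronglyMeasurable V volume) (hV : ∀ ξ, |V ξ| ≤ V₀)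
    (hv : IsCompactTest v v₁) : Integrable fun y => (L ^ 2 + y ^ 2) * V y * v y ^ 2 := by
  obtain ⟨hc, -, -, -⟩ := basic_of_isCompactTest hv
  obtain ⟨hwv, -⟩ := weighted_of_isCompactTest (L := L) hv
  have hV0 : 0 ≤ V₀ := (abs_nonneg _).trans (hV 0)
  refine (hwv.const_mul V₀).mono' ?_ (Eventually.of_forall fun y => ?_)
  · exact (((by fun_prop : AEStronglyMeasurable (fun y : ℝ => L ^ 2 + y ^ 2) volume).mul hVm).mul
      (hc.pow 2).aestronglyMeasurable)
  · rw [Real.norm_eq_abs, show (L ^ 2 + y ^ 2) * V y * v y ^ 2 = V y * ((L ^ 2 + y ^ 2) * v y ^ 2) by ring, abs_mul,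
      abs_of_nonneg (by positivity : (0:ℝ) ≤ (L ^ 2 + y ^ 2) * v y ^ 2)]
    exact mul_le_mul_of_nonneg_right (hV y) (by positivity)

/-- **The generalised backbone identity at the weak level.** For a `C¹` drift `d`, a bounded a.e.-strongly measurable potential `V`
and a compactly supported test `(v, v₁)`:
`linForm L d V v v₁ v v₁ = ∫ (L²+ξ²) v₁² + ∫ ((L²+ξ²)V − 1 − ξ·d − ½(L²+ξ²)·d′) v²`. [folklore] -/
theorem linForm_diag_eq (L : ℝ) {V₀ : ℝ} {d V v v₁ : ℝ → ℝ} (hd : ContDiff ℝ 1 d) (hVm : AEStronglyMeasurable V volume)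
    (hV : ∀ ξ, |V ξ| ≤ V₀) (hv : IsCompactTest v v₁) :
    linForm L d V v v₁ v v₁ =
      (∫ y, (L ^ 2 + y ^ 2) * v₁ y ^ 2) +
        ∫ y, ((L ^ 2 + y ^ 2) * V y - 1 - y * d y - 1 / 2 * (L ^ 2 + y ^ 2) * deriv d y) * v y ^ 2 := by
  obtain ⟨hc, -, -, B, hB0, hB⟩ := basic_of_isCompactTest hv
  obtain ⟨hwv, hwv₁⟩ := weighted_of_isCompactTest (L := L) hv
  have hsupp := hasCompactSupport_of_isCompactTest hv
  have hdc : Continuous d := hd.continuous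
  have hd'c : Continuous (deriv d) := hd.continuous_deriv le_rfl
  have hdd : ∀ y, HasDerivAt d (deriv d y) y := fun y => (hd.differentiable one_ne_zero y).hasDerivAt
  -- the multiplier of the first-order part and its derivative
  set gf : ℝ → ℝ := fun y => 2 * y + (L ^ 2 + y ^ 2) * d y with hgf
  have hgfC : ContDiff ℝ 1 gf := by
    rw [hgf]
    exact ((contDiff_const.mul contDiff_id).add ((contDiff_const.add (contDiff_id.pow 2)).mul hd))
  have hgfd : ∀ y, deriv gf y = 2 + 2 * y * d y + (L ^ 2 + y ^ 2) * deriv d y := by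
    intro y
    have h : HasDerivAt gf (2 * 1 + ((2 * y) * d y + (L ^ 2 + y ^ 2) * deriv d y)) y := by
      rw [hgf]
      have h1 : HasDerivAt (fun y : ℝ => 2 * y) (2 * 1) y := (hasDerivAt_id y).const_mul 2
      have h2 : HasDerivAt (fun y : ℝ => L ^ 2 + y ^ 2) (2 * y) y := by
        have := (hasDerivAt_pow 2 y).const_add (L ^ 2)
        simpa using this
      exact h1.add (h2.mul (hdd y))
    rw [h.deriv]; ring
  -- `gf·v ∈ L²`, so `gf·v·v₁` is integrable
  have hgv2 : MemLp (fun y => gf y * v y) 2 volume :=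
    (hgfC.continuous.mul hc).memLp_of_hasCompactSupport (hsupp.mul_left)
  have hT2 : Integrable fun y => gf y * (v y * v₁ y) := by
    have h := hgv2.integrable_mul hv.memLp
    refine h.congr (Eventually.of_forall fun y => ?_)
    simp only [Pi.mul_apply]; ring
  have hVt : Integrable fun y => (L ^ 2 + y ^ 2) * V y * v y ^ 2 := integrable_weight_potential_mul_sq hVm hV hv
  -- split the diagonal integrand
  have hsplit : linForm L d V v v₁ v v₁ =
      (∫ y, (L ^ 2 + y ^ 2) * v₁ y ^ 2) + (∫ y, gf y * (v y * v₁ y)) + ∫ y, (L ^ 2 + y ^ 2) * V y * v y ^ 2 := by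
    have h12 : Integrable fun y => (L ^ 2 + y ^ 2) * v₁ y ^ 2 + gf y * (v y * v₁ y) := hwv₁.add hT2
    unfold linForm
    rw [← integral_add hwv₁ hT2, ← integral_add h12 hVt]
    refine integral_congr_ae (Eventually.of_forall fun y => ?_)
    simp only [hgf]
    ring
  rw [hsplit, integral_mul_test_eq hgfC hv]
  simp only [hgfd]
  -- `−½∫ (2 + 2ξd + w d′) v² + ∫ wV v² = ∫ (wV − 1 − ξd − ½wd′) v²`
  have hI : Integrable fun y => (2 + 2 * y * d y + (L ^ 2 + y ^ 2) * deriv d y) * v y ^ 2 :=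
    integrable_continuous_mul_sq (by fun_prop) hv
  have e : -(1 / 2) * (∫ y, (2 + 2 * y * d y + (L ^ 2 + y ^ 2) * deriv d y) * v y ^ 2) + ∫ y, (L ^ 2 + y ^ 2) * V y * v y ^ 2 =
      ∫ y, ((L ^ 2 + y ^ 2) * V y - 1 - y * d y - 1 / 2 * (L ^ 2 + y ^ 2) * deriv d y) * v y ^ 2 := by
    rw [← integral_const_mul, ← integral_add (hI.const_mul _) hVt]
    refine integral_congr_ae (Eventually.of_forall fun y => ?_)
    ring
  rw [add_assoc, e]

/-! ### §2 Coercivity from the pointwise inequality -/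

/-- **Coercivity from a pointwise datum.** If `κ ≤ 1` and `(κ/4)(L²+ξ²) ≤ (L²+ξ²)V(ξ) − 1 − ξd(ξ) − ½(L²+ξ²)d′(ξ)` for every `ξ`
(`d ∈ C¹`, `V` bounded measurable), then `κ(‖v₁‖²_w + ¼‖v‖²_w) ≤ linForm(v; v)` on every compactly supported test — the hypothesis
`hcoer` of `SheetRSolutionOperator.exists_solutionOperator`. [folklore] -/
theorem coercive_of_pointwise (L : ℝ) {V₀ κ : ℝ} {d V : ℝ → ℝ} (hd : ContDiff ℝ 1 d) (hVm : AEStronglyMeasurable V volume)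
    (hV : ∀ ξ, |V ξ| ≤ V₀) (hκ1 : κ ≤ 1)
    (hpt : ∀ ξ, κ / 4 * (L ^ 2 + ξ ^ 2) ≤ (L ^ 2 + ξ ^ 2) * V ξ - 1 - ξ * d ξ - 1 / 2 * (L ^ 2 + ξ ^ 2) * deriv d ξ)
    {v v₁ : ℝ → ℝ} (hv : IsCompactTest v v₁) :
    κ * ((∫ ξ, (L ^ 2 + ξ ^ 2) * v₁ ξ ^ 2) + 1 / 4 * ∫ ξ, (L ^ 2 + ξ ^ 2) * v ξ ^ 2) ≤ linForm L d V v v₁ v v₁ := by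
  rw [linForm_diag_eq L hd hVm hV hv]
  obtain ⟨hwv, hwv₁⟩ := weighted_of_isCompactTest (L := L) hv
  have hd'c : Continuous (deriv d) := hd.continuous_deriv le_rfl
  have hdc : Continuous d := hd.continuous
  have hP : Integrable fun y => ((L ^ 2 + y ^ 2) * V y - 1 - y * d y - 1 / 2 * (L ^ 2 + y ^ 2) * deriv d y) * v y ^ 2 := by
    have h1 : Integrable fun y => (L ^ 2 + y ^ 2) * V y * v y ^ 2 := integrable_weight_potential_mul_sq hVm hV hv
    have h2 : Integrable fun y => (-1 - y * d y - 1 / 2 * (L ^ 2 + y ^ 2) * deriv d y) * v y ^ 2 :=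
      integrable_continuous_mul_sq (by fun_prop) hv
    refine (h1.add h2).congr (Eventually.of_forall fun y => ?_)
    simp only [Pi.add_apply]; ring
  have hmono : κ / 4 * ∫ ξ, (L ^ 2 + ξ ^ 2) * v ξ ^ 2 ≤
      ∫ y, ((L ^ 2 + y ^ 2) * V y - 1 - y * d y - 1 / 2 * (L ^ 2 + y ^ 2) * deriv d y) * v y ^ 2 := by
    rw [← integral_const_mul]
    refine integral_mono (hwv.const_mul _) hP fun y => ?_
    have := mul_le_mul_of_nonneg_right (hpt y) (sq_nonneg (v y))
    simpa only [mul_assoc] using this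
  have hnn : 0 ≤ ∫ ξ, (L ^ 2 + ξ ^ 2) * v₁ ξ ^ 2 := integral_nonneg fun y => by positivity
  nlinarith

/-! ### §3 The solution operator and uniqueness, with (C1) discharged by the pointwise datum -/

variable {L D₀ D₁ V₀ : ℝ} {d V : ℝ → ℝ}

/-- **Solution operator from the pointwise datum.** `L > 0`; `d ∈ C¹` with `|d(ξ)| ≤ D₀ + D₁|ξ|`, `V` bounded a.e.-strongly measurable;
`0 < κ ≤ 1` with `(κ/4)(L²+ξ²) ≤ (L²+ξ²)V − 1 − ξd − ½(L²+ξ²)d′` pointwise.  Then there is a bounded linear `S : W L →L[ℝ] Esp L hL`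
solving the weak equation of `(−∂² + d∂ + V)u = g` against every compactly supported test, with `‖S g‖ ≤ (2/κ)‖g‖`. [folklore] -/
theorem exists_solutionOperator_of_pointwise (hL : 0 < L) (hd : ContDiff ℝ 1 d) (hVm : AEStronglyMeasurable V volume)
    (hD₁ : 0 ≤ D₁) (hdg : ∀ ξ, |d ξ| ≤ D₀ + D₁ * |ξ|) (hV : ∀ ξ, |V ξ| ≤ V₀) {κ : ℝ} (hκ : 0 < κ) (hκ1 : κ ≤ 1)
    (hpt : ∀ ξ, κ / 4 * (L ^ 2 + ξ ^ 2) ≤ (L ^ 2 + ξ ^ 2) * V ξ - 1 - ξ * d ξ - 1 / 2 * (L ^ 2 + ξ ^ 2) * deriv d ξ) :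
    ∃ S : W L →L[ℝ] Esp L hL,
      (∀ (g : W L) (v v₁ : ℝ → ℝ), IsCompactTest v v₁ →
        linForm L d V (prim (der (S g))) (der (S g)) v v₁ = ∫ y, (L ^ 2 + y ^ 2) * ((g : ℝ → ℝ) y * v y)) ∧
      ∀ g : W L, ‖S g‖ ≤ 2 / κ * ‖g‖ :=
  exists_solutionOperator hL hd.continuous.aestronglyMeasurable hVm hD₁ hdg hV hκ
    (fun _ _ hv => coercive_of_pointwise L hd hVm hV hκ1 hpt hv)

/-- **Uniqueness from the pointwise datum**: two energy-space weak solutions with the same right-hand side coincide. [folklore] -/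
theorem solution_unique_of_pointwise (hL : 0 < L) (hd : ContDiff ℝ 1 d) (hVm : AEStronglyMeasurable V volume)
    (hD₀ : 0 ≤ D₀) (hD₁ : 0 ≤ D₁) (hdg : ∀ ξ, |d ξ| ≤ D₀ + D₁ * |ξ|) (hV : ∀ ξ, |V ξ| ≤ V₀) {κ : ℝ} (hκ : 0 < κ) (hκ1 : κ ≤ 1)
    (hpt : ∀ ξ, κ / 4 * (L ^ 2 + ξ ^ 2) ≤ (L ^ 2 + ξ ^ 2) * V ξ - 1 - ξ * d ξ - 1 / 2 * (L ^ 2 + ξ ^ 2) * deriv d ξ)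
    {rhs : (ℝ → ℝ) → (ℝ → ℝ) → ℝ} {p q : Esp L hL}
    (hp : ∀ v v₁ : ℝ → ℝ, IsCompactTest v v₁ → linForm L d V (prim (der p)) (der p) v v₁ = rhs v v₁)
    (hq : ∀ v v₁ : ℝ → ℝ, IsCompactTest v v₁ → linForm L d V (prim (der q)) (der q) v v₁ = rhs v v₁) : p = q :=
  solution_unique hL hd.continuous.aestronglyMeasurable hVm hD₀ hD₁ hdg hV hκ
    (fun _ _ hv => coercive_of_pointwise L hd hVm hV hκ1 hpt hv) hp hq

/-! ### §4 The sheet's coefficients: `d = ½ξ + a𝒰̄`, `V = 1 − HΩ̄ + λχ`, `𝒰̄′ = HΩ̄` -/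

variable {a lam : ℝ} {U h χ : ℝ → ℝ}

/-- The sheet drift `ξ ↦ ½ξ + a·U(ξ)` is `C¹` when `U′ = h` with `h` continuous, and its derivative is `½ + a·h`. [folklore] -/
theorem sheet_drift_contDiff (hU : ∀ ξ, HasDerivAt U (h ξ) ξ) (hh : Continuous h) :
    ContDiff ℝ 1 (fun ξ => ξ / 2 + a * U ξ) ∧ ∀ ξ, deriv (fun ξ => ξ / 2 + a * U ξ) ξ = 1 / 2 + a * h ξ := by
  have hder : ∀ ξ, HasDerivAt (fun ξ => ξ / 2 + a * U ξ) (1 / 2 + a * h ξ) ξ := fun ξ =>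
    ((hasDerivAt_id ξ).div_const 2).add ((hU ξ).const_mul a) |>.congr_deriv (by simp)
  have hderiv : deriv (fun ξ => ξ / 2 + a * U ξ) = fun ξ => 1 / 2 + a * h ξ := funext fun ξ => (hder ξ).deriv
  refine ⟨?_, fun ξ => (hder ξ).deriv⟩
  rw [contDiff_one_iff_deriv]
  exact ⟨fun ξ => (hder ξ).differentiableAt, by rw [hderiv]; fun_prop⟩

/-- **The sheet's pointwise potential is PRICE-impl1's `κ_λ·w`.** With `d = ½ξ + aU`, `V = 1 − h + λχ` and `U′ = h`:
`(L²+ξ²)V − 1 − ξd − ½(L²+ξ²)d′ = (¾L² − 1 + ¼ξ²) − (1 + a/2)(L²+ξ²)h − aξU + λ(L²+ξ²)χ`. [folklore] -/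
theorem sheet_potential_eq (L : ℝ) (hU : ∀ ξ, HasDerivAt U (h ξ) ξ) (hh : Continuous h) (ξ : ℝ) :
    (L ^ 2 + ξ ^ 2) * (1 - h ξ + lam * χ ξ) - 1 - ξ * (ξ / 2 + a * U ξ)
        - 1 / 2 * (L ^ 2 + ξ ^ 2) * deriv (fun ξ => ξ / 2 + a * U ξ) ξ =
      (3 / 4 * L ^ 2 - 1 + ξ ^ 2 / 4) - (1 + a / 2) * ((L ^ 2 + ξ ^ 2) * h ξ) - a * ξ * U ξ + lam * ((L ^ 2 + ξ ^ 2) * χ ξ) := by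
  rw [(sheet_drift_contDiff (a := a) hU hh).2 ξ]
  ring

/-- **(C1) from `κ_λ ≥ κ/4`.** If `U′ = h` with `h` continuous, `χ` arbitrary, `V = 1 − h + λχ` bounded measurable, and PRICE-impl1's
`κ_λ(ξ) = (¾L² − 1 + ¼ξ²)/w − (1 + a/2)h − aξU/w + λχ ≥ κ/4` at every `ξ` (`w = L² + ξ²`, `κ ≤ 1`), then the weak form of
`B_λ = −∂² + (½ξ + aU)∂ + (1 − h + λχ)` is `κ`-coercive on compactly supported tests. [folklore] -/
theorem sheet_coercive_of_kappa (L : ℝ) (hL : 0 < L) {V₀ κ : ℝ} (hU : ∀ ξ, HasDerivAt U (h ξ) ξ) (hh : Continuous h)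
    (hVm : AEStronglyMeasurable (fun ξ => 1 - h ξ + lam * χ ξ) volume) (hV : ∀ ξ, |1 - h ξ + lam * χ ξ| ≤ V₀) (hκ1 : κ ≤ 1)
    (hkappa : ∀ ξ, κ / 4 ≤ (3 / 4 * L ^ 2 - 1 + ξ ^ 2 / 4) / (L ^ 2 + ξ ^ 2) - (1 + a / 2) * h ξ
      - a * ξ * U ξ / (L ^ 2 + ξ ^ 2) + lam * χ ξ)
    {v v₁ : ℝ → ℝ} (hv : IsCompactTest v v₁) :
    κ * ((∫ ξ, (L ^ 2 + ξ ^ 2) * v₁ ξ ^ 2) + 1 / 4 * ∫ ξ, (L ^ 2 + ξ ^ 2) * v ξ ^ 2) ≤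
      linForm L (fun ξ => ξ / 2 + a * U ξ) (fun ξ => 1 - h ξ + lam * χ ξ) v v₁ v v₁ := by
  refine coercive_of_pointwise L (sheet_drift_contDiff hU hh).1 hVm hV hκ1 (fun ξ => ?_) hv
  rw [sheet_potential_eq L hU hh ξ]
  have hw : 0 < L ^ 2 + ξ ^ 2 := by positivity
  have hmul := mul_le_mul_of_nonneg_right (hkappa ξ) hw.le
  have e : ((3 / 4 * L ^ 2 - 1 + ξ ^ 2 / 4) / (L ^ 2 + ξ ^ 2) - (1 + a / 2) * h ξ - a * ξ * U ξ / (L ^ 2 + ξ ^ 2) + lam * χ ξ)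
      * (L ^ 2 + ξ ^ 2) =
      (3 / 4 * L ^ 2 - 1 + ξ ^ 2 / 4) - (1 + a / 2) * ((L ^ 2 + ξ ^ 2) * h ξ) - a * ξ * U ξ + lam * ((L ^ 2 + ξ ^ 2) * χ ξ) := by
    rw [add_mul, sub_mul, sub_mul, div_mul_cancel₀ _ hw.ne', div_mul_cancel₀ _ hw.ne']
    ring
  rw [e] at hmul
  linarith

/-- **The bounded inverse of `B_λ` from the pointwise (C1) datum.** `L > 0`; `U′ = h`, `h` continuous with `|h| ≤ H₀`, `|U| ≤ U₀`
(`U₀ ≥ 0`), `χ` a.e.-strongly measurable with `|χ| ≤ X₀`; `0 < κ ≤ 1` and `κ_λ ≥ κ/4` pointwise (PRICE-impl1 (C1): `κ = 1`).  Then there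
is a bounded linear `S : W L →L[ℝ] Esp L hL` solving the weak equation of `B_λu = g`, `B_λ = −∂² + (½ξ + aU)∂ + (1 − h + λχ)`, against
every compactly supported odd energy-class test, with `‖S g‖_E ≤ (2/κ)‖g‖_w`; and energy-space weak solutions with a common right-hand
side coincide. [folklore] -/
theorem exists_sheet_solutionOperator (hL : 0 < L) {H₀ U₀ X₀ κ : ℝ} (hU : ∀ ξ, HasDerivAt U (h ξ) ξ) (hh : Continuous h)
    (hhb : ∀ ξ, |h ξ| ≤ H₀) (hU₀ : 0 ≤ U₀) (hUb : ∀ ξ, |U ξ| ≤ U₀) (hχm : AEStronglyMeasurable χ volume) (hχb : ∀ ξ, |χ ξ| ≤ X₀)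
    (hκ : 0 < κ) (hκ1 : κ ≤ 1)
    (hkappa : ∀ ξ, κ / 4 ≤ (3 / 4 * L ^ 2 - 1 + ξ ^ 2 / 4) / (L ^ 2 + ξ ^ 2) - (1 + a / 2) * h ξ
      - a * ξ * U ξ / (L ^ 2 + ξ ^ 2) + lam * χ ξ) :
    (∃ S : W L →L[ℝ] Esp L hL,
      (∀ (g : W L) (v v₁ : ℝ → ℝ), IsCompactTest v v₁ →
        linForm L (fun ξ => ξ / 2 + a * U ξ) (fun ξ => 1 - h ξ + lam * χ ξ) (prim (der (S g))) (der (S g)) v v₁ =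
          ∫ y, (L ^ 2 + y ^ 2) * ((g : ℝ → ℝ) y * v y)) ∧
      ∀ g : W L, ‖S g‖ ≤ 2 / κ * ‖g‖) ∧
    ∀ {rhs : (ℝ → ℝ) → (ℝ → ℝ) → ℝ} {p q : Esp L hL},
      (∀ v v₁ : ℝ → ℝ, IsCompactTest v v₁ →
        linForm L (fun ξ => ξ / 2 + a * U ξ) (fun ξ => 1 - h ξ + lam * χ ξ) (prim (der p)) (der p) v v₁ = rhs v v₁) →
      (∀ v v₁ : ℝ → ℝ, IsCompactTest v v₁ →
        linForm L (fun ξ => ξ / 2 + a * U ξ) (fun ξ => 1 - h ξ + lam * χ ξ) (prim (der q)) (der q) v v₁ = rhs v v₁) → p = q := by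
  obtain ⟨hdC, hdd⟩ := sheet_drift_contDiff (a := a) hU hh
  -- growth of the drift and boundedness / measurability of the potential
  have hdg : ∀ ξ, |ξ / 2 + a * U ξ| ≤ |a| * U₀ + 1 / 2 * |ξ| := fun ξ => by
    calc |ξ / 2 + a * U ξ| ≤ |ξ / 2| + |a * U ξ| := abs_add_le _ _
      _ = 1 / 2 * |ξ| + |a| * |U ξ| := by rw [abs_div, abs_two, abs_mul]; ring
      _ ≤ 1 / 2 * |ξ| + |a| * U₀ := by nlinarith [hUb ξ, abs_nonneg a]
      _ = |a| * U₀ + 1 / 2 * |ξ| := by ring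
  have hVm : AEStronglyMeasurable (fun ξ => 1 - h ξ + lam * χ ξ) volume :=
    (aestronglyMeasurable_const.sub hh.aestronglyMeasurable).add (aestronglyMeasurable_const.mul hχm)
  have hV : ∀ ξ, |1 - h ξ + lam * χ ξ| ≤ 1 + H₀ + |lam| * X₀ := fun ξ => by
    calc |1 - h ξ + lam * χ ξ| ≤ |1 - h ξ| + |lam * χ ξ| := abs_add_le _ _
      _ ≤ (|(1:ℝ)| + |h ξ|) + |lam| * |χ ξ| := by rw [abs_mul]; exact add_le_add (abs_sub _ _) le_rfl
      _ ≤ (1 + H₀) + |lam| * X₀ := by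
          rw [abs_one]; nlinarith [hhb ξ, hχb ξ, abs_nonneg lam]
  have hcoer : ∀ v v₁ : ℝ → ℝ, IsCompactTest v v₁ →
      κ * ((∫ ξ, (L ^ 2 + ξ ^ 2) * v₁ ξ ^ 2) + 1 / 4 * ∫ ξ, (L ^ 2 + ξ ^ 2) * v ξ ^ 2) ≤
        linForm L (fun ξ => ξ / 2 + a * U ξ) (fun ξ => 1 - h ξ + lam * χ ξ) v v₁ v v₁ :=
    fun v v₁ hv => sheet_coercive_of_kappa L hL hU hh hVm hV hκ1 hkappa hv
  refine ⟨exists_solutionOperator hL hdC.continuous.aestronglyMeasurable hVm (by norm_num : (0:ℝ) ≤ 1 / 2) hdg hV hκ hcoer, ?_⟩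
  intro rhs p q hp hq
  exact solution_unique hL hdC.continuous.aestronglyMeasurable hVm (by positivity : (0:ℝ) ≤ |a| * U₀) (by norm_num : (0:ℝ) ≤ 1 / 2)
    hdg hV hκ hcoer hp hq

end SheetRLinearisedCoercivity
end Summit.NavierStokesRegularity.OSWSelfSimilar

end
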